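import Summits.BirchSwinnertonDyer.BirchSwinnertonDyer.Theorems.RamifiedSevenEllipticUnitsLemmaXi
import HarnessLib

set_option linter.dupNamespace false
set_option autoImplicit false

/-!
# Lemma Ξ, kernel side (III): at a prime RAMIFIED in a quadratic field, `α / σ(α)` is a principal
# unit — the value-level input of (P1)/(P5) reduced to "`φ_ac(ϖ_w) = τ(α / σα)` with `(α) ∣ w`"

Helper file for the K7r Value crux `EllipticUnitValueSevenOfGZK` (stmt-BirchSwinnertonDyer-19945), line
`rubin-formula-zp` v4, stub `stub_rubinPackageSevenZp`, clauses (P1)/(P5). Files (I)/(II)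
(`…LemmaXiAvatarNorm`, `…LemmaXi`) reduce (P1) and (P5) to statements about the `p`-adic size of the
values `φ_ac(ϖ_w) = φ(ϖ_w)/φ(ϖ_{σw})`, which for the Grössencharacter of a CM curve are `τ(α/σα)` for a
generator `α` of (a power of) `w` and an embedding `τ : K → ℚ̄_p` (Deuring; Silverman ATAEC II
Cor. 10.4.1 (a)). This file supplies the arithmetic of the CM field at the ramified prime:

* `smul_sub_mem_of_dvd_discr` — for a quadratic number field `K`, a prime `p ∣ d_K` and the prime
  `𝔭 ∣ p` of `K`, EVERY `σ ∈ Aut(K/ℚ)` acts trivially on `𝓞_K/𝔭`: `σx − x ∈ 𝔭` (the inertia group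
  of the ramified `𝔭` is all of `Gal(K/ℚ)`: Mathlib `Ideal.card_inertia_eq_ramificationIdxIn` + Dedekind's
  discriminant theorem `NumberField.not_dvd_discr_iff_isUnramifiedIn` + the fundamental identity);
  `eq_asIdeal_of_dvd_discr` (`𝔭` is the only prime above `p`), `span_natCast_eq_sq_of_dvd_discr`
  (`p𝓞_K = 𝔭²`);
* `norm_embedding_lt_one_iff_mem` — for ANY ring map `τ : K →+* ℚ̄_p`, `‖τ x‖ < 1 ↔ x ∈ 𝔭` on `𝓞_K`
  (the prime cut out by `τ` lies above `p`, hence is `𝔭`); so `‖τ x‖ = 1` off `𝔭` and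
  `‖τ x‖² ≤ p⁻¹` on `𝔭` (`x² ∈ 𝔭² = (p)`);
* MAIN `norm_embedding_div_smul_sub_one_sq_le` — for `α ∈ 𝓞_K ∖ 𝔭` and `σ ∈ Aut(K/ℚ)`:
  `‖τ(α/σα) − 1‖² ≤ p⁻¹` in `ℂ_p` (so `τ(α/σα)` is a principal unit), with EQUALITY
  (`norm_embedding_div_smul_sub_one_sq_eq`) when `(σα − α)² = p·u` for a `𝔭`-unit `u` (e.g.
  `K = ℚ(√−7)`, `α = (1+√−7)/2`, `σα − α = −√−7`).

References: Silverman, *Advanced Topics in the Arithmetic of Elliptic Curves*, II Cor. 10.4.1;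
Neukirch, *Algebraic Number Theory*, I (8.2)–(9.6), III (2.6)–(2.12); Cox, *Primes of the form
x² + ny²*, Prop. 5.16.
-/

noncomputable section

open scoped Classical NNReal Topology Pointwise
open NumberField IsDedekindDomain Field
  Literature.NumberTheory.GaloisRepresentations

namespace Summit.BirchSwinnertonDyer.BirchSwinnertonDyer.Theorems.RamifiedSevenEllipticUnits

namespace LemmaXi

variable {K : Type} [Field K] [NumberField K] {p : ℕ} [hp : Fact p.Prime]

/-! ## §1 A ramified prime of a quadratic field: inertia is everything -/

omit [NumberField K] in
/-- A prime `𝔭` of `K` containing the rational prime `p` lies over `pℤ`. [folklore] -/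
theorem liesOver_span_of_natCast_mem (𝔭 : HeightOneSpectrum (𝓞 K))
    (hp𝔭 : ((p : ℕ) : 𝓞 K) ∈ 𝔭.asIdeal) : 𝔭.asIdeal.LiesOver (Ideal.span {(p : ℤ)}) :=
  (Ideal.liesOver_span_iff 𝔭.isPrime.ne_top (Nat.prime_iff_prime_int.mp hp.out)).mpr
    (by simpa using hp𝔭)

/-- **A prime dividing the discriminant of a QUADRATIC field is totally ramified**: `e = 2`, one prime
above `p`, residue degree `1` (Dedekind's discriminant theorem + the fundamental identity `efg = 2`).
[cite: NeukirchANT1999, Ch. III §2 Thm. (2.6) and Cor. (2.12); Ch. I §9 Prop. (9.6)] -/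
theorem ramificationIdxIn_eq_two_of_dvd_discr (h2 : Module.finrank ℚ K = 2)
    (hdvd : (p : ℤ) ∣ NumberField.discr K) :
    (Ideal.span {(p : ℤ)}).ramificationIdxIn (𝓞 K) = 2 ∧
      ((Ideal.span {(p : ℤ)}).primesOver (𝓞 K)).ncard = 1 ∧
      (Ideal.span {(p : ℤ)}).inertiaDegIn (𝓞 K) = 1 := by
  haveI : Algebra.IsQuadraticExtension ℚ K := ⟨h2⟩
  haveI : IsGaloisGroup (K ≃ₐ[ℚ] K) ℤ (𝓞 K) :=
    IsGaloisGroup.of_isFractionRing (K ≃ₐ[ℚ] K) ℤ (𝓞 K) ℚ K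
  have hG : Nat.card (K ≃ₐ[ℚ] K) = 2 := by rw [IsGalois.card_aut_eq_finrank, h2]
  have hpZ : Prime (p : ℤ) := Nat.prime_iff_prime_int.mp hp.out
  haveI : (Ideal.span {(p : ℤ)}).IsPrime := (Ideal.span_singleton_prime hpZ.ne_zero).mpr hpZ
  have hram : ¬ Algebra.IsUnramifiedIn (𝓞 K) (Ideal.span {(p : ℤ)}) := fun h ↦
    (NumberField.not_dvd_discr_iff_isUnramifiedIn K (𝓞 K) hpZ).mpr h hdvd
  have he1 : (Ideal.span {(p : ℤ)}).ramificationIdxIn (𝓞 K) ≠ 1 := by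
    intro h1
    apply hram
    rw [Algebra.isUnramifiedIn_iff_forall_ramificationIdx_eq_one]
    intro Q _ hQ
    rw [← Ideal.ramificationIdxIn_eq_ramificationIdx (Ideal.span {(p : ℤ)}) Q (K ≃ₐ[ℚ] K)]
    exact h1
  have hefg := Ideal.ncard_primesOver_mul_ramificationIdxIn_mul_inertiaDegIn
    (Ideal.span {(p : ℤ)}) (𝓞 K) (K ≃ₐ[ℚ] K)
  rw [hG] at hefg
  set g := ((Ideal.span {(p : ℤ)}).primesOver (𝓞 K)).ncard
  set e := (Ideal.span {(p : ℤ)}).ramificationIdxIn (𝓞 K)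
  set f := (Ideal.span {(p : ℤ)}).inertiaDegIn (𝓞 K)
  have he2 : e ≤ 2 := Nat.le_of_dvd two_pos ⟨g * f, by rw [← hefg]; ring⟩
  have hg2 : g ≤ 2 := Nat.le_of_dvd two_pos ⟨e * f, by rw [← hefg]⟩
  have hf2 : f ≤ 2 := Nat.le_of_dvd two_pos ⟨g * e, by rw [← hefg]; ring⟩
  interval_cases e <;> interval_cases g <;> interval_cases f <;> simp_all

/-- **Every automorphism acts trivially modulo a ramified prime of a quadratic field**: for
`[K : ℚ] = 2`, `p ∣ d_K`, `𝔭 ∋ p`, `σ ∈ Aut(K/ℚ)` and `x ∈ 𝓞_K`: `σx − x ∈ 𝔭` (the inertia group of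
`𝔭` has order `e = 2 = #Gal(K/ℚ)`). [cite: NeukirchANT1999, Ch. I §9 Prop. (9.6)] -/
theorem smul_sub_mem_of_dvd_discr (h2 : Module.finrank ℚ K = 2) (hdvd : (p : ℤ) ∣ NumberField.discr K)
    (𝔭 : HeightOneSpectrum (𝓞 K)) (hp𝔭 : ((p : ℕ) : 𝓞 K) ∈ 𝔭.asIdeal) (σ : K ≃ₐ[ℚ] K) (x : 𝓞 K) :
    σ • x - x ∈ 𝔭.asIdeal := by
  haveI : Algebra.IsQuadraticExtension ℚ K := ⟨h2⟩
  haveI : IsGaloisGroup (K ≃ₐ[ℚ] K) ℤ (𝓞 K) :=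
    IsGaloisGroup.of_isFractionRing (K ≃ₐ[ℚ] K) ℤ (𝓞 K) ℚ K
  have hG : Nat.card (K ≃ₐ[ℚ] K) = 2 := by rw [IsGalois.card_aut_eq_finrank, h2]
  have hpZ : Prime (p : ℤ) := Nat.prime_iff_prime_int.mp hp.out
  haveI : (Ideal.span {(p : ℤ)}).IsPrime := (Ideal.span_singleton_prime hpZ.ne_zero).mpr hpZ
  haveI := 𝔭.isPrime
  haveI := liesOver_span_of_natCast_mem 𝔭 hp𝔭
  haveI : Finite (ℤ ⧸ Ideal.span {(p : ℤ)}) :=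
    Ideal.finiteQuotientOfFreeOfNeBot _ (by simpa using hpZ.ne_zero)
  haveI : PerfectField (Ideal.span {(p : ℤ)}).ResidueField := PerfectField.ofFinite
  have hcard : Nat.card (Ideal.inertia (K ≃ₐ[ℚ] K) 𝔭.asIdeal) = Nat.card (K ≃ₐ[ℚ] K) := by
    rw [Ideal.card_inertia_eq_ramificationIdxIn (Ideal.span {(p : ℤ)}) 𝔭.asIdeal,
      (ramificationIdxIn_eq_two_of_dvd_discr h2 hdvd).1, hG]
  have htop := Subgroup.eq_top_of_card_eq _ hcard
  have hσ : σ ∈ Ideal.inertia (K ≃ₐ[ℚ] K) 𝔭.asIdeal := htop ▸ Subgroup.mem_top σ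
  exact hσ x

/-- **`𝔭` is the only prime of `K` above a ramified `p`** (`g = 1`). [cite: NeukirchANT1999, Ch. I §9 Prop. (9.6)] -/
theorem eq_asIdeal_of_dvd_discr (h2 : Module.finrank ℚ K = 2) (hdvd : (p : ℤ) ∣ NumberField.discr K)
    (𝔭 : HeightOneSpectrum (𝓞 K)) (hp𝔭 : ((p : ℕ) : 𝓞 K) ∈ 𝔭.asIdeal) {Q : Ideal (𝓞 K)}
    [hQ : Q.IsPrime] (hpQ : ((p : ℕ) : 𝓞 K) ∈ Q) : Q = 𝔭.asIdeal := by
  have hpZ : Prime (p : ℤ) := Nat.prime_iff_prime_int.mp hp.out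
  have hQ' : Q ∈ (Ideal.span {(p : ℤ)}).primesOver (𝓞 K) :=
    ⟨hQ, (Ideal.liesOver_span_iff hQ.ne_top hpZ).mpr (by simpa using hpQ)⟩
  have hP' : 𝔭.asIdeal ∈ (Ideal.span {(p : ℤ)}).primesOver (𝓞 K) :=
    ⟨𝔭.isPrime, liesOver_span_of_natCast_mem 𝔭 hp𝔭⟩
  obtain ⟨a, ha⟩ := Set.ncard_eq_one.mp (ramificationIdxIn_eq_two_of_dvd_discr h2 hdvd).2.1
  rw [ha, Set.mem_singleton_iff] at hQ' hP'
  rw [hQ', hP']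

/-- **`p𝓞_K = 𝔭²`** at a ramified prime of a quadratic field. [cite: NeukirchANT1999, Ch. I §8 Prop. (8.2)] -/
theorem span_natCast_eq_sq_of_dvd_discr (h2 : Module.finrank ℚ K = 2)
    (hdvd : (p : ℤ) ∣ NumberField.discr K) (𝔭 : HeightOneSpectrum (𝓞 K))
    (hp𝔭 : ((p : ℕ) : 𝓞 K) ∈ 𝔭.asIdeal) : Ideal.span {((p : ℕ) : 𝓞 K)} = 𝔭.asIdeal ^ 2 := by
  haveI : Algebra.IsQuadraticExtension ℚ K := ⟨h2⟩
  haveI : IsGaloisGroup (K ≃ₐ[ℚ] K) ℤ (𝓞 K) :=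
    IsGaloisGroup.of_isFractionRing (K ≃ₐ[ℚ] K) ℤ (𝓞 K) ℚ K
  have hpZ : Prime (p : ℤ) := Nat.prime_iff_prime_int.mp hp.out
  haveI : (Ideal.span {(p : ℤ)}).IsPrime := (Ideal.span_singleton_prime hpZ.ne_zero).mpr hpZ
  haveI : (Ideal.span {(p : ℤ)}).IsMaximal := IsPrime.to_maximal_ideal (by simpa using hpZ.ne_zero)
  haveI := 𝔭.isPrime
  haveI := liesOver_span_of_natCast_mem 𝔭 hp𝔭
  obtain ⟨he, hg, -⟩ := ramificationIdxIn_eq_two_of_dvd_discr (K := K) h2 hdvd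
  have hP' : 𝔭.asIdeal ∈ (Ideal.span {(p : ℤ)}).primesOver (𝓞 K) := ⟨𝔭.isPrime, ‹_›⟩
  obtain ⟨a, ha⟩ := Set.ncard_eq_one.mp hg
  have haP : a = 𝔭.asIdeal := by rw [ha, Set.mem_singleton_iff] at hP'; exact hP'.symm
  have hmap := Ideal.map_algebraMap_eq_finsetProd_pow (R := 𝓞 K) (p := Ideal.span {(p : ℤ)})
    (by simpa using hpZ.ne_zero)
  rw [Ideal.map_span, Set.image_singleton, map_natCast] at hmap
  rw [hmap]
  have hfin : ((Ideal.span {(p : ℤ)}).primesOver (𝓞 K)).toFinset = {𝔭.asIdeal} := by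
    rw [← Set.toFinset_singleton]; exact Set.toFinset_congr (ha.trans (by rw [haP]))
  rw [hfin, Finset.prod_singleton, ← Ideal.ramificationIdxIn_eq_ramificationIdx (Ideal.span {(p : ℤ)})
    𝔭.asIdeal (K ≃ₐ[ℚ] K), he]

/-! ## §2 An embedding `τ : K → ℚ̄_p` sees `𝔭` -/

omit [NumberField K] in
/-- `‖p‖ = p⁻¹` in `ℚ̄_p` for the image of `p ∈ 𝓞_K` under `τ ∘ (𝓞_K → K)`. [folklore] -/
theorem norm_embedding_natCast (τ : K →+* PadicAlgCl p) :
    ‖(τ.comp (algebraMap (𝓞 K) K)) ((p : ℕ) : 𝓞 K)‖ = ((p : ℝ))⁻¹ := by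
  rw [map_natCast, ← map_natCast (algebraMap ℚ_[p] (PadicAlgCl p)) p, PadicAlgCl.norm_extends,
    Padic.norm_p]

/-- **The prime cut out by ANY embedding `τ : K → ℚ̄_p` is `𝔭`**: for `x ∈ 𝓞_K`, `‖τ x‖ < 1 ↔ x ∈ 𝔭`
(`{‖τ ·‖ < 1}` is a prime of `𝓞_K` above `p`, and `𝔭` is the only one).
[cite: NeukirchANT1999, Ch. II §8 Prop. (8.2) (extensions of valuations ↔ primes)] -/
theorem norm_embedding_lt_one_iff_mem (h2 : Module.finrank ℚ K = 2)
    (hdvd : (p : ℤ) ∣ NumberField.discr K) (𝔭 : HeightOneSpectrum (𝓞 K))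
    (hp𝔭 : ((p : ℕ) : 𝓞 K) ∈ 𝔭.asIdeal) (τ : K →+* PadicAlgCl p) (x : 𝓞 K) :
    ‖τ (x : K)‖ < 1 ↔ x ∈ 𝔭.asIdeal := by
  let τ' : 𝓞 K →+* PadicAlgCl p := τ.comp (algebraMap (𝓞 K) K)
  have hle : ∀ y : 𝓞 K, ‖τ' y‖ ≤ 1 := fun y ↦ norm_embedding_coe_le_one τ y
  -- the prime `Q = {‖τ ·‖ < 1}` of `𝓞 K`
  let Q : Ideal (𝓞 K) :=
    { carrier := {y : 𝓞 K | ‖τ' y‖ < 1}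
      add_mem' := fun {a b} ha hb ↦ by
        simp only [Set.mem_setOf_eq, map_add] at ha hb ⊢
        exact (IsUltrametricDist.norm_add_le_max _ _).trans_lt (max_lt ha hb)
      zero_mem' := by simp
      smul_mem' := fun c y hy ↦ by
        simp only [Set.mem_setOf_eq, smul_eq_mul, map_mul, norm_mul] at hy ⊢
        exact mul_lt_one_of_nonneg_of_lt_one_right (hle c) (norm_nonneg _) hy }
  have hQmem : ∀ y : 𝓞 K, y ∈ Q ↔ ‖τ' y‖ < 1 := fun y ↦ Iff.rfl
  haveI hQ : Q.IsPrime := by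
    refine ⟨?_, fun {a b} hab ↦ ?_⟩
    · rw [Ideal.ne_top_iff_one, hQmem, map_one, norm_one]
      exact lt_irrefl 1
    · rw [hQmem, map_mul, norm_mul] at hab
      by_contra h
      push Not at h
      have ha : 1 ≤ ‖τ' a‖ := not_lt.mp (mt (hQmem a).mpr h.1)
      have hb : 1 ≤ ‖τ' b‖ := not_lt.mp (mt (hQmem b).mpr h.2)
      exact absurd hab (not_lt.mpr (one_le_mul_of_one_le_of_one_le ha hb))
  have hpQ : ((p : ℕ) : 𝓞 K) ∈ Q := by
    rw [hQmem, norm_embedding_natCast]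
    exact inv_lt_one_of_one_lt₀ (by exact_mod_cast hp.out.one_lt)
  change ‖τ' x‖ < 1 ↔ _
  rw [← hQmem, eq_asIdeal_of_dvd_discr h2 hdvd 𝔭 hp𝔭 hpQ]

/-- Off `𝔭`, `‖τ x‖ = 1`. [cite: NeukirchANT1999, Ch. II §8 Prop. (8.2)] -/
theorem norm_embedding_eq_one_of_not_mem (h2 : Module.finrank ℚ K = 2)
    (hdvd : (p : ℤ) ∣ NumberField.discr K) (𝔭 : HeightOneSpectrum (𝓞 K))
    (hp𝔭 : ((p : ℕ) : 𝓞 K) ∈ 𝔭.asIdeal) (τ : K →+* PadicAlgCl p) {x : 𝓞 K}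
    (hx : x ∉ 𝔭.asIdeal) : ‖τ (x : K)‖ = 1 :=
  le_antisymm (norm_embedding_coe_le_one τ x)
    (not_lt.mp (mt (norm_embedding_lt_one_iff_mem h2 hdvd 𝔭 hp𝔭 τ x).mp hx))

/-- On `𝔭`, `‖τ x‖² ≤ p⁻¹` (`x² ∈ 𝔭² = p𝓞_K`). [cite: NeukirchANT1999, Ch. II §8 Prop. (8.2)] -/
theorem norm_embedding_sq_le_of_mem (h2 : Module.finrank ℚ K = 2)
    (hdvd : (p : ℤ) ∣ NumberField.discr K) (𝔭 : HeightOneSpectrum (𝓞 K))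
    (hp𝔭 : ((p : ℕ) : 𝓞 K) ∈ 𝔭.asIdeal) (τ : K →+* PadicAlgCl p) {x : 𝓞 K}
    (hx : x ∈ 𝔭.asIdeal) : ‖τ (x : K)‖ ^ 2 ≤ ((p : ℝ))⁻¹ := by
  let τ' : 𝓞 K →+* PadicAlgCl p := τ.comp (algebraMap (𝓞 K) K)
  have hx2 : x ^ 2 ∈ Ideal.span {((p : ℕ) : 𝓞 K)} := by
    rw [span_natCast_eq_sq_of_dvd_discr h2 hdvd 𝔭 hp𝔭]
    exact Ideal.pow_mem_pow hx 2
  obtain ⟨y, hy⟩ := Ideal.mem_span_singleton'.mp hx2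
  change ‖τ' x‖ ^ 2 ≤ _
  calc ‖τ' x‖ ^ 2 = ‖τ' (x ^ 2)‖ := by rw [map_pow, norm_pow]
    _ = ‖τ' y‖ * ‖τ' ((p : ℕ) : 𝓞 K)‖ := by rw [← hy, map_mul, norm_mul]
    _ ≤ 1 * ((p : ℝ))⁻¹ := by
        rw [norm_embedding_natCast]
        exact mul_le_mul_of_nonneg_right (norm_embedding_coe_le_one τ y) (by positivity)
    _ = ((p : ℝ))⁻¹ := one_mul _

/-! ## §3 `α / σ(α)` is a principal unit -/

/-- **MAIN.** For a quadratic number field `K`, a prime `p ∣ d_K` with its prime `𝔭`, any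
`σ ∈ Aut(K/ℚ)`, any embedding `τ : K → ℚ̄_p` and any `α ∈ 𝓞_K ∖ 𝔭`:
`‖τ(α / σα) − 1‖² ≤ p⁻¹` in `ℂ_p` — `τ(α/σα)` is a principal unit (`σα − α ∈ 𝔭`, `σα ∉ 𝔭`).
This is the value-level input of LEMMA Ξ / (P5) for `φ_ac(ϖ_w) = τ(α/σα)` (Deuring).
[cite: SilvermanATAEC1994, Ch. II Cor. 10.4.1 (a) (ψ(𝔓) generates N𝔓)] [cite: NeukirchANT1999, Ch. I §9 Prop. (9.6)] -/
theorem norm_embedding_div_smul_sub_one_sq_le (h2 : Module.finrank ℚ K = 2)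
    (hdvd : (p : ℤ) ∣ NumberField.discr K) (𝔭 : HeightOneSpectrum (𝓞 K))
    (hp𝔭 : ((p : ℕ) : 𝓞 K) ∈ 𝔭.asIdeal) (σ : K ≃ₐ[ℚ] K) (τ : K →+* PadicAlgCl p) {α : 𝓞 K}
    (hα : α ∉ 𝔭.asIdeal) :
    ‖((τ ((α : K) / σ (α : K)) : PadicAlgCl p) : ℂ_[p]) - 1‖ ^ 2 ≤ ((p : ℝ))⁻¹ := by
  let τ' : 𝓞 K →+* PadicAlgCl p := τ.comp (algebraMap (𝓞 K) K)
  have hδ : σ • α - α ∈ 𝔭.asIdeal := smul_sub_mem_of_dvd_discr h2 hdvd 𝔭 hp𝔭 σ α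
  have hσα : σ • α ∉ 𝔭.asIdeal := fun h ↦ hα (by simpa using Ideal.sub_mem _ h hδ)
  have h1 : ‖τ' (σ • α)‖ = 1 := norm_embedding_eq_one_of_not_mem h2 hdvd 𝔭 hp𝔭 τ hσα
  have hcoe : τ' (σ • α) = τ (σ (α : K)) := rfl
  have hne : τ (σ (α : K)) ≠ 0 := by
    intro h0; rw [hcoe, h0, norm_zero] at h1; exact zero_ne_one h1
  have hval : τ ((α : K) / σ (α : K)) - 1 = -(τ' (σ • α - α) / τ (σ (α : K))) := by
    rw [map_div₀, map_sub, hcoe]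
    change τ (α : K) / τ (σ (α : K)) - 1 = -((τ (σ (α : K)) - τ (α : K)) / τ (σ (α : K)))
    field_simp
    ring
  rw [PadicComplex.coe_eq, ← map_one (algebraMap (PadicAlgCl p) ℂ_[p]), ← map_sub,
    ← PadicComplex.coe_eq, PadicComplex.norm_extends, hval, norm_neg, norm_div, ← hcoe, h1, div_one]
  exact norm_embedding_sq_le_of_mem h2 hdvd 𝔭 hp𝔭 τ hδ

/-- **The equality case**: if moreover `(σα − α)² = p · u` with `u ∉ 𝔭`, then
`‖τ(α / σα) − 1‖² = p⁻¹` exactly (e.g. `K = ℚ(√−7)`, `p = 7`, `α = (1 + √−7)/2` a generator of a prime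
above `2`: `σα − α = −√−7`, `u = −1`). [cite: NeukirchANT1999, Ch. I §9 Prop. (9.6)] -/
theorem norm_embedding_div_smul_sub_one_sq_eq (h2 : Module.finrank ℚ K = 2)
    (hdvd : (p : ℤ) ∣ NumberField.discr K) (𝔭 : HeightOneSpectrum (𝓞 K))
    (hp𝔭 : ((p : ℕ) : 𝓞 K) ∈ 𝔭.asIdeal) (σ : K ≃ₐ[ℚ] K) (τ : K →+* PadicAlgCl p) {α u : 𝓞 K}
    (hα : α ∉ 𝔭.asIdeal) (hu : u ∉ 𝔭.asIdeal) (hδ : (σ • α - α) ^ 2 = (p : ℕ) * u) :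
    ‖((τ ((α : K) / σ (α : K)) : PadicAlgCl p) : ℂ_[p]) - 1‖ ^ 2 = ((p : ℝ))⁻¹ := by
  let τ' : 𝓞 K →+* PadicAlgCl p := τ.comp (algebraMap (𝓞 K) K)
  have hδm : σ • α - α ∈ 𝔭.asIdeal := smul_sub_mem_of_dvd_discr h2 hdvd 𝔭 hp𝔭 σ α
  have hσα : σ • α ∉ 𝔭.asIdeal := fun h ↦ hα (by simpa using Ideal.sub_mem _ h hδm)
  have h1 : ‖τ' (σ • α)‖ = 1 := norm_embedding_eq_one_of_not_mem h2 hdvd 𝔭 hp𝔭 τ hσα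
  have hu1 : ‖τ' u‖ = 1 := norm_embedding_eq_one_of_not_mem h2 hdvd 𝔭 hp𝔭 τ hu
  have hcoe : τ' (σ • α) = τ (σ (α : K)) := rfl
  have hne : τ (σ (α : K)) ≠ 0 := by
    intro h0; rw [hcoe, h0, norm_zero] at h1; exact zero_ne_one h1
  have hval : τ ((α : K) / σ (α : K)) - 1 = -(τ' (σ • α - α) / τ (σ (α : K))) := by
    rw [map_div₀, map_sub, hcoe]
    change τ (α : K) / τ (σ (α : K)) - 1 = -((τ (σ (α : K)) - τ (α : K)) / τ (σ (α : K)))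
    field_simp
    ring
  have hδ2 : ‖τ' (σ • α - α)‖ ^ 2 = ((p : ℝ))⁻¹ := by
    rw [← norm_pow, ← map_pow, hδ, map_mul, norm_mul, norm_embedding_natCast, hu1, mul_one]
  rw [PadicComplex.coe_eq, ← map_one (algebraMap (PadicAlgCl p) ℂ_[p]), ← map_sub,
    ← PadicComplex.coe_eq, PadicComplex.norm_extends, hval, norm_neg, norm_div, ← hcoe, h1, div_one, hδ2]

end LemmaXi

end Summit.BirchSwinnertonDyer.BirchSwinnertonDyer.Theorems.RamifiedSevenEllipticUnits

end
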